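import Summits.ResolutionOfSingularities.ResolutionOfSingularities.Theorems.PurelyInseparableDim4JointRoot
import HarnessLib

/-!
# Purely inseparable four-folds: a NON-VACUITY INSTANCE of the joint chain — `z^p + x₁^p x₃ + x₂^p x₄` is
# order-reduced by ONE coordinate blow-up, for every prime `p` (brick S3 (c) «joint point∘coordinate chains», part 5)

[OURS · counted 0] (D-0157 DOOR 2; desk WORD #66 (4)(c); frame `PIDim4.TerminationImpliesOrderReduction`, S3 (c);
host item stmt-ResolutionOfSingularities-16155, helper). Nothing here proves resolution of singularities in
dimension ≥ 4 / characteristic `p` — NOT here, not anywhere in this programme.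

`F = x₁^p x₃ + x₂^p x₄` (`K = K̄` of characteristic `p`, any prime `p`). The order-`p` locus of `z^p + F` is the whole
SURFACE `V(z, x₁, x₂) ⊂ 𝔸⁵` (`surface_subset_support`): positive-dimensional, so the point regime's theorems (finitely
many root parameters) are VACUOUS for this `F`. The coordinate centre `V(z, x₁, x₂)` is Hironaka-permissible
(`isPermissibleCentre_inst`); in both charts of its blow-up the transform acquires a LINEAR monomial (`x₃`, resp. `x₄`)
that survives every translation (`not_isEquimultiplePoint_inst`), so there is no equimultiple pair; and there is no
root parameter off the centre (`roots_inst`: the linear coefficients of `F(x + b)` are `b₁^p`, `b₂^p`). Hence, by the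
root form of the joint chain (`exists_isMarkedResolution_coord_root_then_walk`, part 3):

* **`exists_isMarkedResolution_inst`** — for every algebraically closed `K` of characteristic `p`, the marked ideal
  `(𝔸⁵_K, (z^p + x₁^p x₃ + x₂^p x₄)·𝒪, [], p)` admits a marked resolution (BGMW Def. 3.1.3): ANY blowing up of `𝔸⁵_K`
  along `V(z, x₁, x₂)` is one. An unconditional instance of the conclusion of `PIDim4.OrderReduction p` reached
  through a positive-dimensional centre — the hypotheses of the joint chain are satisfiable where the point chain's
  are not.

§1 polynomial computations (`coeff_single_X_add_C_pow_mul`: the linear coefficients of `(x_a + u)^p (x_c + v)` in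
characteristic `p`; chart transforms, cleanliness, permissibility); §2 the certificate. AI-produced formalisation,
weaker than expert review. bears_on: LADDER-RESOLUTION:D157-DOOR2 (res-dim4-pi · S3 (c) joint · instance).
-/

set_option linter.dupNamespace false -- D-0017: single-problem summit path `Summit.<S>.<S>.…` by design

noncomputable section

open MvPolynomial Finset CategoryTheory AlgebraicGeometry Opposite TopologicalSpace

namespace Summit.ResolutionOfSingularities.ResolutionOfSingularities.Theorems.PIDim4

open Literature.AlgebraicGeometry.Resolution
open Literature.AlgebraicGeometry.Resolution.Hauser2010
open Literature.AlgebraicGeometry.Resolution.AffinePointBlowup (P A γ coord Wtop ξ)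

namespace Equimultiple

section Instance

variable {K : Type} [Field K] {p : ℕ} [hp : Fact p.Prime] [CharP K p]

/-! ## §1 Polynomial computations for `F = x₁^p x₃ + x₂^p x₄` and the centre `S = {x₁, x₂}` -/

omit hp [CharP K p] in
/-- `x_a^p x_c` as a monomial. [folklore] -/
theorem X_pow_mul_X_eq_monomial (a c : Fin 4) :
    (X a ^ p * X c : MvPolynomial (Fin 4) K) = monomial (Finsupp.single a p + Finsupp.single c 1) 1 := by
  rw [X_pow_eq_monomial, X, monomial_mul, mul_one]

/-- **The linear coefficients of `(x_a + u)^p (x_c + v)` in characteristic `p`**: `(x_a + u)^p = x_a^p + u^p`, so the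
coefficient of `x_i` (`i ≠ a`) is `u^p` if `i = c` and `0` otherwise. [folklore] -/
theorem coeff_single_X_add_C_pow_mul {i a c : Fin 4} (hia : i ≠ a) (u v : K) :
    coeff (Finsupp.single i 1) ((X a + C u) ^ p * (X c + C v) : MvPolynomial (Fin 4) K) =
      if i = c then u ^ p else 0 := by
  have h1 : ¬ (Finsupp.single i 1 : Fin 4 →₀ ℕ) = 0 := Finsupp.single_ne_zero.mpr one_ne_zero
  have hexp : ((X a + C u) ^ p * (X c + C v) : MvPolynomial (Fin 4) K) =
      monomial (Finsupp.single a p + Finsupp.single c 1) 1 + C v * monomial (Finsupp.single a p) 1 +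
        C (u ^ p) * X c + C (u ^ p * v) := by
    rw [add_pow_char, ← map_pow, ← X_pow_mul_X_eq_monomial, ← X_pow_eq_monomial, map_mul]
    ring
  have hXc : coeff (Finsupp.single i 1) (X c : MvPolynomial (Fin 4) K) = if i = c then 1 else 0 := by
    rw [X, coeff_monomial]
    by_cases hic : i = c
    · rw [if_pos hic, if_pos (by rw [hic])]
    · rw [if_neg hic, if_neg fun h => hic ((Finsupp.single_left_inj one_ne_zero).mp h).symm]
  rw [hexp, coeff_add, coeff_add, coeff_add, coeff_C_mul, coeff_C_mul, coeff_C, if_neg (Ne.symm h1), add_zero,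
    coeff_monomial, if_neg, zero_add, coeff_monomial, if_neg, mul_zero, zero_add, hXc]
  · split_ifs <;> simp
  · intro h
    have := DFunLike.congr_fun h a
    rw [Finsupp.single_eq_same, Finsupp.single_eq_of_ne hia.symm] at this
    exact hp.out.ne_zero this
  · intro h
    have := DFunLike.congr_fun h a
    rw [Finsupp.add_apply, Finsupp.single_eq_same, Finsupp.single_eq_of_ne hia.symm] at this
    exact hp.out.ne_zero (Nat.eq_zero_of_add_eq_zero_right this)

omit hp [CharP K p] in
/-- `Σ_{i ∈ {x₁, x₂}} dᵢ = d₁ + d₂`. [folklore] -/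
theorem degIn_pair (d : Fin 4 →₀ ℕ) : CentreBlowup.degIn ({0, 1} : Finset (Fin 4)) d = d 0 + d 1 := by
  rw [CentreBlowup.degIn, Finset.sum_pair (by decide : (0 : Fin 4) ≠ 1)]

omit hp [CharP K p] in
/-- The support of `x₁^p x₃ + x₂^p x₄` consists of its two exponents. [folklore] -/
theorem mem_support_inst {d : Fin 4 →₀ ℕ}
    (hd : d ∈ (X 0 ^ p * X 2 + X 1 ^ p * X 3 : MvPolynomial (Fin 4) K).support) :
    d = Finsupp.single 0 p + Finsupp.single 2 1 ∨ d = Finsupp.single 1 p + Finsupp.single 3 1 := by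
  rw [X_pow_mul_X_eq_monomial, X_pow_mul_X_eq_monomial] at hd
  rcases Finset.mem_union.mp (Finset.mem_of_subset MvPolynomial.support_add hd) with hd' | hd'
  · exact Or.inl (Finset.mem_singleton.mp (Finset.mem_of_subset support_monomial_subset hd'))
  · exact Or.inr (Finset.mem_singleton.mp (Finset.mem_of_subset support_monomial_subset hd'))

omit hp [CharP K p] in
/-- `x₁^p x₃ + x₂^p x₄ ≠ 0`. [folklore] -/
theorem inst_ne_zero : (X 0 ^ p * X 2 + X 1 ^ p * X 3 : MvPolynomial (Fin 4) K) ≠ 0 := by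
  intro h
  have hc := congrArg (coeff (Finsupp.single (0 : Fin 4) p + Finsupp.single 2 1)) h
  rw [coeff_add, X_pow_mul_X_eq_monomial, X_pow_mul_X_eq_monomial, coeff_monomial, if_pos rfl, coeff_monomial,
    if_neg, coeff_zero, add_zero] at hc
  · exact one_ne_zero hc
  · intro heq
    have := DFunLike.congr_fun heq 2
    simp at this

omit [CharP K p] in
/-- `x₁^p x₃ + x₂^p x₄` is clean (each monomial has an exponent `1`, not divisible by `p`).
[cite: HauserPerlega2019PRIMS, §2 (cleaning)] -/
theorem isClean_inst :
    Literature.Barriers.ResolutionOfSingularities.HauserPerlega.IsClean p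
      (X 0 ^ p * X 2 + X 1 ^ p * X 3 : MvPolynomial (Fin 4) K) := by
  intro d hd hpth
  rcases mem_support_inst hd with rfl | rfl
  · have h0 : (Finsupp.single 0 p + Finsupp.single 2 1 : Fin 4 →₀ ℕ) 2 = 1 := by simp
    have h := hpth 2 (by rw [Finsupp.mem_support_iff, h0]; exact one_ne_zero)
    rw [h0] at h
    exact hp.out.one_lt.ne' (Nat.dvd_one.mp h)
  · have h0 : (Finsupp.single 1 p + Finsupp.single 3 1 : Fin 4 →₀ ℕ) 3 = 1 := by simp
    have h := hpth 3 (by rw [Finsupp.mem_support_iff, h0]; exact one_ne_zero)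
    rw [h0] at h
    exact hp.out.one_lt.ne' (Nat.dvd_one.mp h)

omit hp [CharP K p] in
/-- **`V(z, x₁, x₂)` is Hironaka-permissible for `z^p + x₁^p x₃ + x₂^p x₄`**: both monomials have `{x₁, x₂}`-degree `p`.
[cite: HauserPerlega2019PRIMS, §2 (condition (1) f ∈ P^{c!})] -/
theorem isPermissibleCentre_inst :
    IsPermissibleCentre p ({0, 1} : Finset (Fin 4)) (X 0 ^ p * X 2 + X 1 ^ p * X 3 : MvPolynomial (Fin 4) K) := by
  refine ⟨⟨0, Finset.mem_insert_self _ _⟩, Finset.le_inf fun d hd => ?_⟩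
  rcases mem_support_inst hd with rfl | rfl <;> simp [degIn_pair]

omit hp [CharP K p] in
/-- **The order-`p` locus is the whole surface `V(z, x₁, x₂)`**: every point of the centre has order `≥ p` — the
positive-dimensional situation where the point regime's finite-root hypotheses cannot hold.
[cite: Hauser2010, §F (equiconstant points)] -/
theorem surface_subset_support :
    (AffineCoordBlowup.CΛ 4 K (insert 0 (Fin.succ '' ((({0, 1} : Finset (Fin 4)) : Set (Fin 4))))) : Set (P 4 K)) ⊆
      (⟨hypSheaf p (X 0 ^ p * X 2 + X 1 ^ p * X 3 : MvPolynomial (Fin 4) K), [], p⟩ : MarkedIdeal (P 4 K)).support :=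
  ChartDictionary.CΛ_subset_support p _ _ isPermissibleCentre_inst.2 []

omit hp [CharP K p] in
/-- The chart transform of `x₁^p x₃ + x₂^p x₄` in the `x₁`-chart of the blow-up of `V(z, x₁, x₂)` is `x₃ + x₂^p x₄`.
[cite: HauserPerlega2019PRIMS, §2 (the blowup in the x₁-chart)] -/
theorem chartTransform_inst_zero :
    CentreBlowup.chartTransform p ({0, 1} : Finset (Fin 4)) 0 (X 0 ^ p * X 2 + X 1 ^ p * X 3 : MvPolynomial (Fin 4) K) =
      X 2 + X 1 ^ p * X 3 := by
  rw [X_pow_mul_X_eq_monomial, X_pow_mul_X_eq_monomial, CentreBlowup.chartTransform_monomial_add_monomial,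
    CentreBlowup.chartExponent, CentreBlowup.chartExponent, degIn_pair, degIn_pair]
  have e1 : (Finsupp.single 0 p + Finsupp.single 2 1 : Fin 4 →₀ ℕ).update 0
      ((Finsupp.single 0 p + Finsupp.single 2 1 : Fin 4 →₀ ℕ) 0 +
        (Finsupp.single 0 p + Finsupp.single 2 1 : Fin 4 →₀ ℕ) 1 - p) = Finsupp.single 2 1 := by
    ext i; fin_cases i <;> simp [Finsupp.update_apply]
  have e2 : (Finsupp.single 1 p + Finsupp.single 3 1 : Fin 4 →₀ ℕ).update 0
      ((Finsupp.single 1 p + Finsupp.single 3 1 : Fin 4 →₀ ℕ) 0 +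
        (Finsupp.single 1 p + Finsupp.single 3 1 : Fin 4 →₀ ℕ) 1 - p) = Finsupp.single 1 p + Finsupp.single 3 1 := by
    ext i; fin_cases i <;> simp [Finsupp.update_apply]
  rw [e1, e2, ← X_pow_mul_X_eq_monomial]
  rfl

omit hp [CharP K p] in
/-- The chart transform in the `x₂`-chart is `x₁^p x₃ + x₄`. [cite: HauserPerlega2019PRIMS, §2 (the blowup in the x₁-chart)] -/
theorem chartTransform_inst_one :
    CentreBlowup.chartTransform p ({0, 1} : Finset (Fin 4)) 1 (X 0 ^ p * X 2 + X 1 ^ p * X 3 : MvPolynomial (Fin 4) K) =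
      X 0 ^ p * X 2 + X 3 := by
  rw [X_pow_mul_X_eq_monomial, X_pow_mul_X_eq_monomial, CentreBlowup.chartTransform_monomial_add_monomial,
    CentreBlowup.chartExponent, CentreBlowup.chartExponent, degIn_pair, degIn_pair]
  have e1 : (Finsupp.single 0 p + Finsupp.single 2 1 : Fin 4 →₀ ℕ).update 1
      ((Finsupp.single 0 p + Finsupp.single 2 1 : Fin 4 →₀ ℕ) 0 +
        (Finsupp.single 0 p + Finsupp.single 2 1 : Fin 4 →₀ ℕ) 1 - p) = Finsupp.single 0 p + Finsupp.single 2 1 := by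
    ext i; fin_cases i <;> simp [Finsupp.update_apply]
  have e2 : (Finsupp.single 1 p + Finsupp.single 3 1 : Fin 4 →₀ ℕ).update 1
      ((Finsupp.single 1 p + Finsupp.single 3 1 : Fin 4 →₀ ℕ) 0 +
        (Finsupp.single 1 p + Finsupp.single 3 1 : Fin 4 →₀ ℕ) 1 - p) = Finsupp.single 3 1 := by
    ext i; fin_cases i <;> simp [Finsupp.update_apply]
  rw [e1, e2, ← X_pow_mul_X_eq_monomial]
  rfl

/-- **No point of the exceptional divisor is equimultiple**: in each chart a linear monomial (`x₃`, resp. `x₄`) with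
coefficient `1` survives every translation. [cite: Hauser2010, §F (equiconstant points)] -/
theorem not_isEquimultiplePoint_inst [DecidableEq K] {j : Fin 4} (hj : j ∈ ({0, 1} : Finset (Fin 4))) (b : Fin 4 → K) :
    ¬ CentreBlowup.IsEquimultiplePoint p ({0, 1} : Finset (Fin 4)) j b
      (⟨X 0 ^ p * X 2 + X 1 ^ p * X 3, 0, ∅⟩ : State K) := by
  have hC : ∀ (i : Fin 4) (u : K), coeff (Finsupp.single i 1) (C u : MvPolynomial (Fin 4) K) = 0 := fun i u => by
    rw [coeff_C, if_neg (Ne.symm (Finsupp.single_ne_zero.mpr one_ne_zero))]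
  intro h
  rcases Finset.mem_insert.mp hj with rfl | hj1
  · have h1 := h (Finsupp.single 2 1) (Finsupp.single_ne_zero.mpr one_ne_zero)
      (by rw [Finsupp.degree_single]; exact hp.out.one_lt)
    unfold CentreBlowup.pointTransform PointBlowup.translate at h1
    rw [show (⟨X 0 ^ p * X 2 + X 1 ^ p * X 3, 0, ∅⟩ : State K).F = X 0 ^ p * X 2 + X 1 ^ p * X 3 from rfl,
      chartTransform_inst_zero] at h1
    simp only [map_add, map_mul, map_pow, aeval_X] at h1
    rw [coeff_add, coeff_add, coeff_X, if_pos rfl, hC, add_zero,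
      coeff_single_X_add_C_pow_mul (show (2 : Fin 4) ≠ 1 by decide), if_neg (show (2 : Fin 4) ≠ 3 by decide),
      add_zero] at h1
    exact one_ne_zero h1
  · have hj' : j = 1 := Finset.mem_singleton.mp hj1
    subst hj'
    have h1 := h (Finsupp.single 3 1) (Finsupp.single_ne_zero.mpr one_ne_zero)
      (by rw [Finsupp.degree_single]; exact hp.out.one_lt)
    unfold CentreBlowup.pointTransform PointBlowup.translate at h1
    rw [show (⟨X 0 ^ p * X 2 + X 1 ^ p * X 3, 0, ∅⟩ : State K).F = X 0 ^ p * X 2 + X 1 ^ p * X 3 from rfl,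
      chartTransform_inst_one] at h1
    simp only [map_add, map_mul, map_pow, aeval_X] at h1
    rw [coeff_add, coeff_add, coeff_X, if_pos rfl, hC, add_zero,
      coeff_single_X_add_C_pow_mul (show (3 : Fin 4) ≠ 0 by decide), if_neg (show (3 : Fin 4) ≠ 2 by decide),
      zero_add] at h1
    exact one_ne_zero h1

/-- **The root parameters lie on the centre**: if every non-constant monomial of degree `< p` of `F(x + b)` vanishes
then `b₁ = b₂ = 0` (the coefficients of `x₃`, `x₄` in `F(x + b)` are `b₁^p`, `b₂^p`). [cite: Hauser2010, §F (equiconstant points)] -/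
theorem roots_inst (b : Fin 4 → K)
    (H : ∀ d : Fin 4 →₀ ℕ, d ≠ 0 → d.degree < p →
      coeff d (PointBlowup.translate b (X 0 ^ p * X 2 + X 1 ^ p * X 3 : MvPolynomial (Fin 4) K)) = 0) :
    ∀ i ∈ ({0, 1} : Finset (Fin 4)), b i = 0 := by
  have key : ∀ d : Fin 4 →₀ ℕ, coeff d (PointBlowup.translate b (X 0 ^ p * X 2 + X 1 ^ p * X 3 : MvPolynomial (Fin 4) K)) =
      coeff d ((X 0 + C (b 0)) ^ p * (X 2 + C (b 2)) : MvPolynomial (Fin 4) K) +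
        coeff d ((X 1 + C (b 1)) ^ p * (X 3 + C (b 3)) : MvPolynomial (Fin 4) K) := fun d => by
    unfold PointBlowup.translate
    simp only [map_add, map_mul, map_pow, aeval_X, coeff_add]
  have h2 := H (Finsupp.single 2 1) (Finsupp.single_ne_zero.mpr one_ne_zero)
    (by rw [Finsupp.degree_single]; exact hp.out.one_lt)
  rw [key, coeff_single_X_add_C_pow_mul (show (2 : Fin 4) ≠ 0 by decide), if_pos rfl,
    coeff_single_X_add_C_pow_mul (show (2 : Fin 4) ≠ 1 by decide), if_neg (show (2 : Fin 4) ≠ 3 by decide),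
    add_zero] at h2
  have h3 := H (Finsupp.single 3 1) (Finsupp.single_ne_zero.mpr one_ne_zero)
    (by rw [Finsupp.degree_single]; exact hp.out.one_lt)
  rw [key, coeff_single_X_add_C_pow_mul (show (3 : Fin 4) ≠ 0 by decide), if_neg (show (3 : Fin 4) ≠ 2 by decide),
    coeff_single_X_add_C_pow_mul (show (3 : Fin 4) ≠ 1 by decide), if_pos rfl, zero_add] at h3
  intro i hi
  rcases Finset.mem_insert.mp hi with rfl | hi1
  · exact pow_eq_zero_iff hp.out.ne_zero |>.mp h2
  · rw [Finset.mem_singleton.mp hi1]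
    exact pow_eq_zero_iff hp.out.ne_zero |>.mp h3

/-! ## §2 The certificate -/

/-- **`z^p + x₁^p x₃ + x₂^p x₄` ADMITS A MARKED RESOLUTION BY ONE COORDINATE BLOW-UP** (`K = K̄` of characteristic `p`,
every prime `p`): ANY blowing up `π : W → 𝔸⁵_K` along `V(z, x₁, x₂)` is a marked resolution of
`(𝔸⁵_K, (z^p + x₁^p x₃ + x₂^p x₄)·𝒪, [], p)` (BGMW Def. 3.1.3) — the joint chain's root form with no equimultiple pair
over the centre and no root parameter off it. The order-`p` locus here is a SURFACE (`surface_subset_support`), so this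
instance lies outside the point regime. [cite: BierstoneGrigorievMilmanWlodarczyk2011, Def. 3.1.3]
[cite: HauserPerlega2019PRIMS, §2 (permissible centres P = (z, x_i : i ∈ Γ))] [cite: Hauser2010, §F] -/
theorem exists_isMarkedResolution_inst [IsAlgClosed K] [DecidableEq K] {W : Scheme.{0}} {π : W ⟶ P 4 K}
    (hπ : IsBlowup π (AffineCoordBlowup.𝓘Λ 4 K
      (insert 0 (Fin.succ '' ((({0, 1} : Finset (Fin 4)) : Set (Fin 4))))))) :
    ∃ (X' : Scheme.{0}) (ρ : X' ⟶ P 4 K) (M' : MarkedIdeal X'),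
      IsMarkedResolution (⟨hypSheaf p (X 0 ^ p * X 2 + X 1 ^ p * X 3 : MvPolynomial (Fin 4) K), [], p⟩ :
        MarkedIdeal (P 4 K)) ρ M' := by
  refine exists_isMarkedResolution_coord_root_then_walk (X 0 ^ p * X 2 + X 1 ^ p * X 3) inst_ne_zero isClean_inst
    isPermissibleCentre_inst hπ (Set.finite_empty.subset ?_) (fun j b hj _ heq => ?_) (Set.finite_empty.subset ?_)
    (fun b H hbS => ?_)
  · rintro ⟨j, b⟩ ⟨hj, -, heq⟩
    exact not_isEquimultiplePoint_inst hj b heq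
  · exact absurd heq (not_isEquimultiplePoint_inst hj b)
  · rintro b ⟨H, hbS⟩
    exact hbS (roots_inst b H)
  · exact absurd (roots_inst b H) hbS

/-- The same for the chosen blowing up `blowup.π`. [cite: BierstoneGrigorievMilmanWlodarczyk2011, Def. 3.1.3] -/
theorem exists_isMarkedResolution_inst' [IsAlgClosed K] [DecidableEq K] :
    ∃ (X' : Scheme.{0}) (ρ : X' ⟶ P 4 K) (M' : MarkedIdeal X'),
      IsMarkedResolution (⟨hypSheaf p (X 0 ^ p * X 2 + X 1 ^ p * X 3 : MvPolynomial (Fin 4) K), [], p⟩ :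
        MarkedIdeal (P 4 K)) ρ M' :=
  exists_isMarkedResolution_inst (blowup.isBlowup _)

end Instance

end Equimultiple

end Summit.ResolutionOfSingularities.ResolutionOfSingularities.Theorems.PIDim4

end
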